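import Literature.AlgebraicGeometry.Frobenioids.PerfectionModelEquivalence
import HarnessLib

/-!
# Frobenioids I, Prop. 5.5 (iv) for `C^pf` of a model Frobenioid, IV: fullness, the equivalence, and the slot
# `FrdI.Prop55Sub.Prop55iv_pf`

Mochizuki, *The geometry of Frobenioids I: the general theory*, Kyushu J. Math. **62** (2008)
293–400, Proposition 5.5 (iv) p. 104 (proof p. 105 ll. 26–27, "immediate from the definitions")
[cite: MochizukiFrdI2008, Prop. 5.5 (iv) p.104].

Sub-node FrdI:Prop5.5(iv)/P55-L08, `C^pf` row, LAST PART.  FULLNESS of the comparison functor `toModelPf`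
(`PerfectionModelFunctor.lean`): a morphism `(d, β, x^{1/k}, u^{1/k'}) : (A_D, α^{1/n}) → (A'_D, α'^{1/m})` of the
model Frobenioid of the perfected data satisfies relation (d) in `(Φ^pf(A_D))^gp`; raising it to the power
`n m k k'` lands in the image of `Φ(A_D)^gp`, where the kernel criterion (`gpToPf_eq_iff`, `Φ(A_D)` integral)
yields an honest relation in `Φ(A_D)^gp` after a further power `N`; that relation is exactly relation (d) for an
explicit arrow `θ : A^{(a)} → A'^{(b)}` of `C` at the level `a = m k k' N`, `b = n k k' N` (`fullRep`), whose class
maps to the given morphism.  With `toModelPf_faithful`, `toModelPf_essSurj` (`PerfectionModelEquivalence.lean`):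
`toModelPf` is an equivalence (`toModelPf_isEquivalence`), and **`prop55iv_pf_holds`** closes the slot
`FrdI.Prop55Sub.Prop55iv_pf` of `Prop55Sub.lean` for THE perfection `PreFrobenioidData.perfection`.
-/

namespace Literature.AlgebraicGeometry.Frobenioids

namespace PreFrobenioid

namespace Perfection

namespace ModelPf

open CategoryTheory Opposite

universe w v u

variable {D : Type u} [Category.{v} D] {Φ B : Dᵒᵖ ⥤ CommMonCat.{w}} {DivB : B ⟶ monoidGp Φ}
  {hF : IsFrobenioid (ModelFrobenioid.toElem Φ B DivB)} {X Y : Perfection hF}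
  (DivBpf : perfectionFunctor B ⟶ monoidGp (perfectionFunctor Φ))

/-! ### Powers of the two sides of relation (d) in `(Φ^pf(A_D))^gp` -/

/-- `((ι α)^{1/n})^{d}` to the power `n e` is `ι(α^{d e})`. [cite: MochizukiFrdI2008, §0 p.11] -/
theorem gpRoot_pow_pow_mul (X : Perfection hF) (d e : ℕ) :
    (gpRoot (Φ.obj (op X.obj.base)) X.idx (gpToPf _ X.obj.cls) ^ d) ^ ((X.idx : ℕ) * e) =
      gpToPf (Φ.obj (op X.obj.base)) (X.obj.cls ^ (d * e)) := by
  rw [← pow_mul, show d * ((X.idx : ℕ) * e) = (X.idx : ℕ) * (d * e) by ring, pow_mul, gpRoot_pow, map_pow]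

/-- `(ι α)^{1/n}` to the power `n e` is `ι(α^{e})`. [cite: MochizukiFrdI2008, §0 p.11] -/
theorem gpRoot_pow_mul' (X : Perfection hF) (e : ℕ) :
    gpRoot (Φ.obj (op X.obj.base)) X.idx (gpToPf _ X.obj.cls) ^ ((X.idx : ℕ) * e) =
      gpToPf (Φ.obj (op X.obj.base)) (X.obj.cls ^ e) := by
  rw [pow_mul, gpRoot_pow, map_pow]

/-- `(x^{1/k})` (as an element of `(Φ^pf)^gp`) to the power `k j` is `ι(x^j)`. [cite: MochizukiFrdI2008, §0 p.11] -/
theorem of_mk_pow_mul {M : Type w} [CommMonoid M] (x : M) (k : ℕ+) (j : ℕ) :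
    Algebra.GrothendieckGroup.of (Frobenioids.Perfection.mk x k) ^ ((k : ℕ) * j) =
      gpToPf M (Algebra.GrothendieckGroup.of (x ^ j)) := by
  rw [← map_pow, Frobenioids.Perfection.mk_pow_mul_self, gpToPf_of]

/-- `Div_B^pf(u^{1/k'})` to the power `k' j` is `ι(Div_B(u^j))`. [cite: MochizukiFrdI2008, Prop. 5.5 (iv) p.104] -/
theorem divBpfAt_mk_pow_mul (hDiv : IsPerfectedDiv Φ B DivB DivBpf) (A : D) (u : B.obj (op A)) (k' : ℕ+) (j : ℕ) :
    divBpfAt (Φ := Φ) DivBpf A (Frobenioids.Perfection.mk u k') ^ ((k' : ℕ) * j) =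
      gpToPf (Φ.obj (op A)) (divB Φ B DivB (op A) (u ^ j)) := by
  rw [pow_mul, divBpfAt_mk_pow DivBpf hDiv, ← map_pow, ← map_pow]

/-! ### Fullness -/

/-- Commutative-group bookkeeping for `full_rel`. [folklore] -/
private theorem full_aux {G : Type w} [CommGroup G] {Aa DA Xj PBb PDu DUj : G} {d : ℕ}
    (hN : Aa ^ d * Xj = PBb * DUj) :
    (Aa * DA⁻¹) ^ d * Xj = PBb * PDu⁻¹ * (DUj * (DA ^ d)⁻¹ * PDu) := by
  calc (Aa * DA⁻¹) ^ d * Xj = Aa ^ d * Xj * (DA ^ d)⁻¹ := by rw [mul_pow, inv_pow, mul_right_comm]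
    _ = PBb * DUj * (DA ^ d)⁻¹ := by rw [hN]
    _ = PBb * PDu⁻¹ * (DUj * (DA ^ d)⁻¹ * PDu) := by
        rw [mul_comm (DUj * (DA ^ d)⁻¹) PDu, mul_assoc PBb PDu⁻¹, inv_mul_cancel_left, mul_assoc]

variable (hB : Objectwise (fun M _ => IsGroupLike M) B) (hDiv : IsPerfectedDiv Φ B DivB DivBpf)

/-- **The comparison functor is full.** [cite: MochizukiFrdI2008, Prop. 5.5 (iv) p.104] -/
theorem toModelPf_full (hΦ : Objectwise (fun M _ => IsDivisorial M) Φ) : (toModelPf hF DivBpf hB hDiv).Full := by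
  refine ⟨fun {X Y} φ' => ?_⟩
  -- the data `(d, β, x^{1/k}, u^{1/k'})` of `φ'` and its relation (d), in plain types
  obtain ⟨d, β, δ, υ, hrel⟩ := φ'
  change X.obj.base ⟶ Y.obj.base at β
  change Frobenioids.Perfection (Φ.obj (op X.obj.base)) at δ
  change Frobenioids.Perfection (B.obj (op X.obj.base)) at υ
  obtain ⟨⟨x, k⟩, rfl⟩ := Frobenioids.Perfection.mk_surjective δ
  obtain ⟨⟨u, k'⟩, rfl⟩ := Frobenioids.Perfection.mk_surjective υ
  have hR : gpRoot (Φ.obj (op X.obj.base)) X.idx (gpToPf _ X.obj.cls) ^ (d : ℕ) *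
      Algebra.GrothendieckGroup.of (Frobenioids.Perfection.mk x k) =
    pullGpPf (Φ := Φ) β (gpRoot (Φ.obj (op Y.obj.base)) Y.idx (gpToPf _ Y.obj.cls)) *
      divBpfAt (Φ := Φ) DivBpf X.obj.base (Frobenioids.Perfection.mk u k') := hrel
  -- raise to the power `n m k k'` and land in the image of `Φ(A_D)^gp`
  haveI : IsCancelMul (Φ.obj (op X.obj.base)) :=
    isIntegral_iff_isCancelMul.mp (hΦ X.obj.base).isPreDivisorial.isIntegral
  have hP := congrArg (fun z => z ^ ((X.idx : ℕ) * ((Y.idx : ℕ) * ((k : ℕ) * (k' : ℕ))))) hR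
  beta_reduce at hP
  rw [mul_pow, mul_pow, gpRoot_pow_pow_mul,
    show (X.idx : ℕ) * ((Y.idx : ℕ) * ((k : ℕ) * (k' : ℕ))) = (k : ℕ) * ((X.idx : ℕ) * (Y.idx : ℕ) * (k' : ℕ)) by ring,
    of_mk_pow_mul, ← map_pow,
    show (k : ℕ) * ((X.idx : ℕ) * (Y.idx : ℕ) * (k' : ℕ)) = (Y.idx : ℕ) * ((X.idx : ℕ) * ((k : ℕ) * (k' : ℕ))) by ring,
    gpRoot_pow_mul', pullGpPf_gpToPf,
    show (Y.idx : ℕ) * ((X.idx : ℕ) * ((k : ℕ) * (k' : ℕ))) = (k' : ℕ) * ((X.idx : ℕ) * (Y.idx : ℕ) * (k : ℕ)) by ring,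
    divBpfAt_mk_pow_mul DivBpf hDiv, ← map_mul, ← map_mul, gpToPf_eq_iff] at hP
  obtain ⟨N, hN⟩ := hP
  rw [mul_pow, mul_pow, ← pow_mul, ← map_pow, ← pow_mul, ← map_pow, ← pow_mul, ← map_pow, ← pow_mul] at hN
  -- the level `a = m k k' N`, `b = n k k' N`
  let t : ℕ+ := k * k' * N
  let a : ℕ+ := Y.idx * t
  let b : ℕ+ := X.idx * t
  have hab : X.idx * a = Y.idx * b := mul_left_comm _ _ _
  let L : Level X Y := ⟨a, b, hab⟩
  let jP : ℕ+ := X.idx * Y.idx * k' * N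
  let jP' : ℕ+ := X.idx * Y.idx * k * N
  have hj : X.idx * a = k * jP := by
    apply PNat.eq; simp only [a, t, jP, PNat.mul_coe]; ring
  have hj' : X.idx * a = k' * jP' := by
    apply PNat.eq; simp only [a, t, jP', PNat.mul_coe]; ring
  -- the chosen Frobenius arrows and their bases
  haveI := isIso_baseMap_frob (hF := hF) X.obj a
  haveI := isIso_baseMap_frob (hF := hF) Y.obj b
  let f := ModelFrobenioid.baseMap (frob hF X.obj a)
  let fB := ModelFrobenioid.baseMap (frob hF Y.obj b)
  let g : (frobPow hF X.obj a).base ⟶ (frobPow hF Y.obj b).base := CategoryTheory.inv f ≫ β ≫ fB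
  have hfg : f ≫ g = β ≫ fB := by simp only [g, IsIso.hom_inv_id_assoc]
  let y : Φ.obj (op (frobPow hF X.obj a).base) := pull Φ (CategoryTheory.inv f) (x ^ (jP : ℕ))
  let uA := ModelFrobenioid.unit (frob hF X.obj a)
  let u' := ModelFrobenioid.unit (frob hF Y.obj b)
  -- an inverse of `u_A^d` in the group-like monoid `B(A_D)`
  obtain ⟨v, hv⟩ : ∃ v : B.obj (op X.obj.base), uA ^ (d : ℕ) * v = 1 := ⟨_, (hB X.obj.base).mul_inv _⟩
  let w : B.obj (op (frobPow hF X.obj a).base) := pull B (CategoryTheory.inv f) (u ^ (jP' : ℕ) * v * pull B β u')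
  have hy : pull Φ f y = x ^ (jP : ℕ) := pull_pull_inv_eq f _
  have hw : pull B f w = u ^ (jP' : ℕ) * v * pull B β u' := pull_pull_inv_eq f _
  have hdv : divB Φ B DivB (op X.obj.base) v = (divB Φ B DivB (op X.obj.base) uA ^ (d : ℕ))⁻¹ := by
    rw [← map_pow]
    exact eq_inv_of_mul_eq_one_right (by rw [← map_mul, hv, map_one])
  -- relation (d) for `θ`
  have hA := cls_pow_eq (hF := hF) X.obj a
  have hA' := cls_pow_eq (hF := hF) Y.obj b
  have hN' : (X.obj.cls ^ (a : ℕ)) ^ (d : ℕ) * Algebra.GrothendieckGroup.of (x ^ (jP : ℕ)) =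
      pullGp Φ β (Y.obj.cls ^ (b : ℕ)) * divB Φ B DivB (op X.obj.base) (u ^ (jP' : ℕ)) := by
    have e1 : (d : ℕ) * ((Y.idx : ℕ) * ((k : ℕ) * (k' : ℕ))) * (N : ℕ) = (a : ℕ) * (d : ℕ) := by
      simp only [a, t, PNat.mul_coe]; ring
    have e2 : (X.idx : ℕ) * (Y.idx : ℕ) * (k' : ℕ) * (N : ℕ) = (jP : ℕ) := by simp only [jP, PNat.mul_coe]
    have e3 : (X.idx : ℕ) * ((k : ℕ) * (k' : ℕ)) * (N : ℕ) = (b : ℕ) := by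
      simp only [b, t, PNat.mul_coe]; ring
    have e4 : (X.idx : ℕ) * (Y.idx : ℕ) * (k : ℕ) * (N : ℕ) = (jP' : ℕ) := by simp only [jP', PNat.mul_coe]
    rw [e1, e2, e3, e4, pow_mul] at hN
    exact hN
  have relθ : (frobPow hF X.obj a).cls ^ ((d : ℕ+) : ℕ) * Algebra.GrothendieckGroup.of y =
      pullGp Φ g (frobPow hF Y.obj b).cls * divB Φ B DivB (op (frobPow hF X.obj a).base) w := by
    apply pullGp_injective (Φ := Φ) f
    rw [map_mul, map_pow, pullGp_of', hy, map_mul, ← pullGp_comp, hfg, pullGp_comp,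
      ModelFrobenioid.pullGp_divB_pull, hw, eq_mul_inv_of_mul_eq hA.symm, eq_mul_inv_of_mul_eq hA'.symm,
      map_mul, map_inv, ModelFrobenioid.pullGp_divB_pull, map_mul, map_mul, hdv]
    exact full_aux hN'
  let θ : frobPow hF X.obj a ⟶ frobPow hF Y.obj b := ModelFrobenioid.mkHom _ _ d g y w relθ
  let r : Rep X Y := ⟨L, θ⟩
  -- the base of the class of `θ`
  have hb : Rep.mbase X Y r = β := by
    change f ≫ g ≫ CategoryTheory.inv fB = β
    simp only [g, Category.assoc, IsIso.hom_inv_id, Category.comp_id, IsIso.hom_inv_id_assoc]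
  refine ⟨Hom.mk r, ModelFrobenioid.hom_ext rfl hb ?_ ?_⟩
  · -- `Div^pf`
    change Rep.pdiv r = Frobenioids.Perfection.mk x k
    rw [Rep.pdiv_eq]
    change Frobenioids.Perfection.mk (pull Φ f y) (X.idx * a) = _
    rw [hy, hj, Frobenioids.Perfection.mk_pow_mul]
  · -- `u^pf`
    change unitPf hB r = Frobenioids.Perfection.mk u k'
    unfold unitPf
    have hunit : unitB hB r = u ^ (jP' : ℕ) := by
      have km := unitB_mul hB r
      rw [hb] at km
      change unitB hB r * pull B β u' = pull B f w * uA ^ ((d : ℕ+) : ℕ) at km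
      rw [hw] at km
      apply (hB X.obj.base).mul_right_cancel (pull B β u')
      have hc : v * (pull B β u' * uA ^ ((d : ℕ+) : ℕ)) = pull B β u' := by
        rw [mul_comm (pull B β u'), ← mul_assoc, mul_comm v, hv, one_mul]
      rw [km, mul_assoc, mul_assoc, hc]
    change Frobenioids.Perfection.mk (unitB hB r) (X.idx * a) = _
    rw [hunit, hj', Frobenioids.Perfection.mk_pow_mul]

/-! ### The equivalence and the slot -/

/-- **The comparison functor `C^pf → (model Frobenioid of Φ^pf, B^pf, Div_B^pf)` is an equivalence of
categories** (faithful, full, essentially surjective). [cite: MochizukiFrdI2008, Prop. 5.5 (iv) p.104] -/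
theorem toModelPf_isEquivalence (hΦ : Objectwise (fun M _ => IsDivisorial M) Φ) :
    (toModelPf hF DivBpf hB hDiv).IsEquivalence :=
  haveI := toModelPf_faithful (hF := hF) DivBpf hB hDiv
  haveI := toModelPf_full (hF := hF) DivBpf hB hDiv hΦ
  haveI := toModelPf_essSurj (hF := hF) DivBpf hB hDiv
  { }

/-- **Proposition 5.5 (iv), `C^pf`** (print p. 104 ll. 40–43), for THE perfection: for `C` the model Frobenioid
of `(Φ, B, Div_B)` (hypotheses of Thm. 5.2) and perfected data `Div_B^pf`, an equivalence
`C^pf ≌ (model Frobenioid of Φ^pf, B^pf, Div_B^pf)` lying over `D`. [cite: MochizukiFrdI2008, Prop. 5.5 (iv) p.104] -/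
theorem exists_equivalence_modelPf (h : ModelFrobenioid.Hypotheses Φ B)
    (DivBpf : perfectionFunctor B ⟶ monoidGp (perfectionFunctor Φ)) (hDiv : IsPerfectedDiv Φ B DivB DivBpf) :
    ∃ e : Perfection (h.isFrobenioid Φ B DivB) ≌
        ModelFrobenioid (perfectionFunctor Φ) (perfectionFunctor B) DivBpf,
      Nonempty (e.functor ⋙ ModelFrobenioid.baseFunctor _ _ _ ≅ (ops (h.isFrobenioid Φ B DivB)).base) := by
  haveI := toModelPf_isEquivalence (hF := h.isFrobenioid Φ B DivB) DivBpf h.isGroupLike_rat hDiv h.isDivisorial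
  exact ⟨(toModelPf (h.isFrobenioid Φ B DivB) DivBpf h.isGroupLike_rat hDiv).asEquivalence,
    ⟨toModelPfBaseIso (h.isFrobenioid Φ B DivB) DivBpf h.isGroupLike_rat hDiv⟩⟩

/-- **The slot `FrdI.Prop55Sub.Prop55iv_pf` of `Prop55Sub.lean`, DISCHARGED for THE perfection** (node
FrdI:Prop5.5(iv), `C^pf` row; print's antecedents "Frobenius-isotropic and Frobenius-normalized type" are not
used). [cite: MochizukiFrdI2008, Prop. 5.5 (iv) p.104] -/
theorem _root_.Literature.AlgebraicGeometry.Frobenioids.FrdI.Prop55Sub.prop55iv_pf_holds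
    (h : ModelFrobenioid.Hypotheses Φ B) (DivBpf : perfectionFunctor B ⟶ monoidGp (perfectionFunctor Φ)) :
    Literature.AlgebraicGeometry.Frobenioids.FrdI.Prop55Sub.Prop55iv_pf Φ B DivB h DivBpf :=
  fun _ _ hDiv => exists_equivalence_modelPf h DivBpf hDiv

end ModelPf

end Perfection

end PreFrobenioid

end Literature.AlgebraicGeometry.Frobenioids
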